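import Summits.AnomalousDissipation.AnomalousDissipation.Theorems.SawtoothPulseCascadeK1LocalisedCascadeSpectralMoments
import Summits.AnomalousDissipation.AnomalousDissipation.Theorems.SawtoothPulseCascadeK1LocalisedCascadeSymbolPackageFibre
import Summits.AnomalousDissipation.AnomalousDissipation.Theorems.SawtoothPulseCascadeK1LocalisedCascadeSymbolPackageLattice

/-!
# K1loc, line `Spectral` / SeqCone — helper: THE SYMBOL SOCKET OF THE H HALF-STEP AT ORDER `r = 1` (S-B constants)

Helper file of the prover lane on the crux `K1LocalisedCascade` (stmt-AnomalousDissipation-19491), route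
`SawtoothPulseCascade` (glue seat k1loc-p3; Stage 2 of the concrete instantiation of `…K1Ledger.cascade_ledger_step_H′`).
The sharp capstone takes, on the symbol side, (i) fibre profiles `Mμ n` of the old symbol with `ContDiff ℝ 1`, `|Mμ| ≤ Cμ 0`,
`|Mμ′| ≤ Cμ 1` (`hMμc/hμM/hCμ`), (ii) shifted squared fibre profiles `Np n, Nm n` of the new symbol (`hNpc/hmNp/hCNp` …),
(iii) lattice moduli `wd, wd₂` (`hω0/hω/hω20/hω2`), which `…SpectralMoments.modulus_of_fibre_lipschitz` produces from a
Lipschitz bound along the `e_v`-axis.  For the PRODUCT symbols of `…SymbolPackageLattice`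
(`μ̂ = 1 − g^S_L·g^env_{R,w}`, `m̂ = 1 − g^M_{L₀}·g^env_{R′,w′}`) this file supplies exactly these data with ABSOLUTE constants at a
common scale `b` (`bγ ≤ ε_aL`, `b ≤ w`): `exists_fibre_data_symProdS_H` (i), `exists_fibre_data_symProdM_H_sq` +
`symProdM_sub_single_sq_eq` (ii), `exists_lipschitz_axis_symProdS_H` / `exists_lipschitz_axis_symProdM_H_sq` (iii).
No definitions; no statement about the stub.  [cite: Grafakos2014, Prop. 3.1.2 (5)] [problem: turb]
-/

-- `Summit.<Summit>.<Problem>`: single-conjunct summit, the duplicate namespace segment is deliberate.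
set_option linter.dupNamespace false

noncomputable section

namespace Summit.AnomalousDissipation.AnomalousDissipation.Theorems.SawtoothPulseCascade.K1Symbol

open Set Filter Topology Real
open scoped ContDiff
open Summit.AnomalousDissipation.AnomalousDissipation.Theorems.SawtoothPulseCascade.K1Cutoff
open Summit.AnomalousDissipation.AnomalousDissipation.Theorems.SawtoothPulseCascade.K1Slot

/-- Components of `k − q` for `q` on the `e_v`-axis of `ℤ²`. [folklore] -/
theorem sub_apply_of_axis (k q : Fin 2 → ℤ) (hq : ∀ l : Fin 2, l ≠ 1 → q l = 0) :
    (k - q) 0 = k 0 ∧ (((k - q) 1 : ℤ) : ℝ) = (k 1 : ℝ) - (q 1 : ℝ) := by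
  refine ⟨?_, ?_⟩
  · rw [Pi.sub_apply, hq 0 (by decide), sub_zero]
  · rw [Pi.sub_apply]; push_cast; ring

/-- The H-fibre cone factor `g^S(n, t)` takes values in `[0,1]`. [folklore] -/
theorem coneFactorH_mem (γ ε εa a L : ℝ) (n : ℤ) (t : ℝ) :
    0 ≤ smoothTransition ((|(n : ℝ)| - L) / (ε * L)) * (1 - smoothTransition ((γ * |t| - a * |(n : ℝ)|) / (εa * L))) ∧
    smoothTransition ((|(n : ℝ)| - L) / (ε * L)) * (1 - smoothTransition ((γ * |t| - a * |(n : ℝ)|) / (εa * L))) ≤ 1 :=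
  ⟨mul_nonneg (Real.smoothTransition.nonneg _) (sub_nonneg.mpr (Real.smoothTransition.le_one _)),
    mul_le_one₀ (Real.smoothTransition.le_one _) (sub_nonneg.mpr (Real.smoothTransition.le_one _))
      (sub_le_self _ (Real.smoothTransition.nonneg _))⟩

/-- The (shifted) fibre envelope factor `g^env(n, t − t₀)` takes values in `[0,1]`. [folklore] -/
theorem envFactor_mem (R w : ℝ) (n : ℤ) (t₀ t : ℝ) :
    0 ≤ (1 - smoothTransition ((|(n : ℝ)| - R) / w)) * (1 - smoothTransition ((|t - t₀| - R) / w)) ∧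
    (1 - smoothTransition ((|(n : ℝ)| - R) / w)) * (1 - smoothTransition ((|t - t₀| - R) / w)) ≤ 1 :=
  ⟨mul_nonneg (sub_nonneg.mpr (Real.smoothTransition.le_one _)) (sub_nonneg.mpr (Real.smoothTransition.le_one _)),
    mul_le_one₀ (sub_le_self _ (Real.smoothTransition.nonneg _)) (sub_nonneg.mpr (Real.smoothTransition.le_one _))
      (sub_le_self _ (Real.smoothTransition.nonneg _))⟩

/-- The (shifted) H-fibre mid-phase factor `g^M(n, t − t₀)` takes values in `[0,1]`. [folklore] -/
theorem midFactorH_mem (γ ε εa a₂ L₀ : ℝ) (n : ℤ) (t₀ t : ℝ) :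
    0 ≤ smoothTransition ((|(n : ℝ)| - L₀) / (ε * L₀)) *
        (1 - smoothTransition ((γ * |t - t₀ + γ * n| - a₂ * |(n : ℝ)|) / (εa * L₀)) *
          smoothTransition ((γ * |t - t₀ - γ * n| - a₂ * |(n : ℝ)|) / (εa * L₀))) ∧
    smoothTransition ((|(n : ℝ)| - L₀) / (ε * L₀)) *
        (1 - smoothTransition ((γ * |t - t₀ + γ * n| - a₂ * |(n : ℝ)|) / (εa * L₀)) *
          smoothTransition ((γ * |t - t₀ - γ * n| - a₂ * |(n : ℝ)|) / (εa * L₀))) ≤ 1 :=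
  ⟨mul_nonneg (Real.smoothTransition.nonneg _) (sub_nonneg.mpr (mul_le_one₀ (Real.smoothTransition.le_one _)
      (Real.smoothTransition.nonneg _) (Real.smoothTransition.le_one _))),
    mul_le_one₀ (Real.smoothTransition.le_one _) (sub_nonneg.mpr (mul_le_one₀ (Real.smoothTransition.le_one _)
      (Real.smoothTransition.nonneg _) (Real.smoothTransition.le_one _)))
      (sub_le_self _ (mul_nonneg (Real.smoothTransition.nonneg _) (Real.smoothTransition.nonneg _)))⟩

/-! ## The old symbol `μ̂ = 1 − g^S_L·g^env_{R,w}` on H-fibres -/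

/-- **First-order fibre data of `μ̂`** (hypotheses `hMμc/hCμ` of `cascade_ledger_step_H′` at `r = 1`, with
`Mμ n t = 1 − g^S(n,t)·g^env(n,t)`): there is an absolute `C ≥ 0` such that for `γ, ε, ε_a, a, L, R, w > 0` and every scale
`0 < b` with `bγ ≤ ε_aL`, `b ≤ w`, each fibre profile is `C¹`, bounded by `1`, with `|Mμ′| ≤ C/b`.
[cite: Grafakos2014, Prop. 3.1.2 (5)] -/
theorem exists_fibre_data_symProdS_H :
    ∃ C : ℝ, 0 ≤ C ∧ ∀ {γ ε εa a L R w b : ℝ}, 0 < γ → 0 < ε → 0 < εa → 0 < a → 0 < L → 0 < R → 0 < w → 0 < b →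
      b * γ ≤ εa * L → b ≤ w → ∀ n : ℤ,
      ContDiff ℝ 1 (fun t : ℝ => 1 - smoothTransition ((|(n : ℝ)| - L) / (ε * L)) *
          (1 - smoothTransition ((γ * |t| - a * |(n : ℝ)|) / (εa * L))) *
          ((1 - smoothTransition ((|(n : ℝ)| - R) / w)) * (1 - smoothTransition ((|t| - R) / w)))) ∧
      (∀ t : ℝ, |1 - smoothTransition ((|(n : ℝ)| - L) / (ε * L)) *
          (1 - smoothTransition ((γ * |t| - a * |(n : ℝ)|) / (εa * L))) *
          ((1 - smoothTransition ((|(n : ℝ)| - R) / w)) * (1 - smoothTransition ((|t| - R) / w)))| ≤ 1) ∧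
      ∀ t : ℝ, |deriv (fun t : ℝ => 1 - smoothTransition ((|(n : ℝ)| - L) / (ε * L)) *
          (1 - smoothTransition ((γ * |t| - a * |(n : ℝ)|) / (εa * L))) *
          ((1 - smoothTransition ((|(n : ℝ)| - R) / w)) * (1 - smoothTransition ((|t| - R) / w)))) t| ≤ C / b := by
  obtain ⟨CS, hCS0, hCS⟩ := exists_bound_deriv_coneFactorH
  obtain ⟨CE, hCE0, hCE⟩ := exists_bound_deriv_envFactor
  refine ⟨CS + CE, by positivity, ?_⟩
  intro γ ε εa a L R w b hγ hε hεa ha hL hR hw hb hbγ hbw n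
  have hS1 : ContDiff ℝ 1 (fun t : ℝ => 1 - smoothTransition ((|(n : ℝ)| - L) / (ε * L)) *
      (1 - smoothTransition ((γ * |t| - a * |(n : ℝ)|) / (εa * L)))) :=
    contDiff_symS_fibreH (γ := γ) hε hεa hL ha (n : ℝ)
  have hS : ContDiff ℝ 1 (fun t : ℝ => smoothTransition ((|(n : ℝ)| - L) / (ε * L)) *
      (1 - smoothTransition ((γ * |t| - a * |(n : ℝ)|) / (εa * L)))) := by
    have e : (fun t : ℝ => smoothTransition ((|(n : ℝ)| - L) / (ε * L)) *
        (1 - smoothTransition ((γ * |t| - a * |(n : ℝ)|) / (εa * L)))) = fun t => 1 - (1 -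
        smoothTransition ((|(n : ℝ)| - L) / (ε * L)) * (1 - smoothTransition ((γ * |t| - a * |(n : ℝ)|) / (εa * L)))) := by
      funext t; ring
    rw [e]; exact contDiff_const.sub hS1
  have hE : ContDiff ℝ 1 (fun t : ℝ => (1 - smoothTransition ((|(n : ℝ)| - R) / w)) *
      (1 - smoothTransition ((|t| - R) / w))) := by
    have h : ContDiff ℝ 1 (fun t : ℝ => (1 - smoothTransition ((|(n : ℝ)| - R) / w)) *
        (1 - smoothTransition ((|t - 0| - R) / w))) :=
      contDiff_envFactor hR hw (1 - smoothTransition ((|(n : ℝ)| - R) / w)) 0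
    simpa only [sub_zero] using h
  refine ⟨contDiff_const.sub (hS.mul hE), fun t => ?_, fun t => ?_⟩
  · obtain ⟨h0, h1⟩ := one_sub_mul_mem (coneFactorH_mem γ ε εa a L n t).1 (coneFactorH_mem γ ε εa a L n t).2
      (by simpa only [sub_zero] using (envFactor_mem R w n 0 t).1) (by simpa only [sub_zero] using (envFactor_mem R w n 0 t).2)
    rw [abs_of_nonneg h0]; exact h1
  · obtain ⟨hdS, hS'⟩ := hCS hγ hε hεa ha hL hb hbγ n t
    have hEt := hCE hR hw hb hbw n 0 t
    simp only [sub_zero] at hEt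
    obtain ⟨hdE, hE'⟩ := hEt
    have hS1' : |smoothTransition ((|(n : ℝ)| - L) / (ε * L)) * (1 - smoothTransition ((γ * |t| - a * |(n : ℝ)|) / (εa * L)))|
        ≤ 1 := by
      rw [abs_of_nonneg (coneFactorH_mem γ ε εa a L n t).1]; exact (coneFactorH_mem γ ε εa a L n t).2
    have hE1' : |(1 - smoothTransition ((|(n : ℝ)| - R) / w)) * (1 - smoothTransition ((|t| - R) / w))| ≤ 1 := by
      have h := envFactor_mem R w n 0 t
      simp only [sub_zero] at h
      rw [abs_of_nonneg h.1]; exact h.2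
    rw [add_div]
    exact abs_deriv_one_sub_mul_le hdS hdE hS1' hE1' hS' hE'

/-- **Lipschitz bound of `μ̂` along the `e_v`-axis** (input `hLip` of `…SpectralMoments.modulus_of_fibre_lipschitz`, which
then yields `hω0/hω` of `cascade_ledger_step_H′` with `wd(q) = (C/b)|q_v|` on the axis and `2` off it): with the constant
of `exists_fibre_data_symProdS_H`, `|μ̂(k) − μ̂(k − q)| ≤ (C/b)|q_v|` for `q ∈ ℤe_v`. [cite: Grafakos2014, Prop. 3.1.2 (5)] -/
theorem exists_lipschitz_axis_symProdS_H :
    ∃ C : ℝ, 0 ≤ C ∧ ∀ {γ ε εa a L R w b : ℝ}, 0 < γ → 0 < ε → 0 < εa → 0 < a → 0 < L → 0 < R → 0 < w → 0 < b →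
      b * γ ≤ εa * L → b ≤ w → ∀ k q : Fin 2 → ℤ, (∀ l : Fin 2, l ≠ 1 → q l = 0) →
        |(1 - smoothTransition ((|(k 0 : ℝ)| - L) / (ε * L)) * (1 - smoothTransition ((γ * |(k 1 : ℝ)| - a * |(k 0 : ℝ)|) / (εa * L))) *
              ((1 - smoothTransition ((|(k 0 : ℝ)| - R) / w)) * (1 - smoothTransition ((|(k 1 : ℝ)| - R) / w)))) -
          (1 - smoothTransition ((|((k - q) 0 : ℝ)| - L) / (ε * L)) *
              (1 - smoothTransition ((γ * |((k - q) 1 : ℝ)| - a * |((k - q) 0 : ℝ)|) / (εa * L))) *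
              ((1 - smoothTransition ((|((k - q) 0 : ℝ)| - R) / w)) * (1 - smoothTransition ((|((k - q) 1 : ℝ)| - R) / w))))| ≤
          C / b * |(q 1 : ℝ)| := by
  obtain ⟨C, hC0, hC⟩ := exists_fibre_data_symProdS_H
  refine ⟨C, hC0, ?_⟩
  intro γ ε εa a L R w b hγ hε hεa ha hL hR hw hb hbγ hbw k q hq
  set Mf : (Fin 2 → ℤ) → ℝ → ℝ := fun k t =>
    1 - smoothTransition ((|(k 0 : ℝ)| - L) / (ε * L)) * (1 - smoothTransition ((γ * |t| - a * |(k 0 : ℝ)|) / (εa * L))) *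
      ((1 - smoothTransition ((|(k 0 : ℝ)| - R) / w)) * (1 - smoothTransition ((|t| - R) / w))) with hMf
  have hdiff : ∀ k, Differentiable ℝ (Mf k) := fun k => (hC hγ hε hεa ha hL hR hw hb hbγ hbw (k 0)).1.differentiable (by simp)
  have hder : ∀ k t, |deriv (Mf k) t| ≤ C / b := fun k t => (hC hγ hε hεa ha hL hR hw hb hbγ hbw (k 0)).2.2 t
  refine abs_sub_le_of_fibre_deriv (μ := fun k : Fin 2 → ℤ =>
    1 - smoothTransition ((|(k 0 : ℝ)| - L) / (ε * L)) * (1 - smoothTransition ((γ * |(k 1 : ℝ)| - a * |(k 0 : ℝ)|) / (εa * L))) *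
      ((1 - smoothTransition ((|(k 0 : ℝ)| - R) / w)) * (1 - smoothTransition ((|(k 1 : ℝ)| - R) / w))))
    (1 : Fin 2) (Mf := Mf) hdiff hder ?_ k q hq
  intro k q hq
  obtain ⟨h0, h1⟩ := sub_apply_of_axis k q hq
  simp only [hMf, h0, h1]

/-! ## The new symbol `m̂ = 1 − g^M_{L₀}·g^env_{R′,w′}` on H-fibres: the shifted squares -/

/-- **First-order fibre data of the shifted squares of `m̂`** (hypotheses `hNpc/hNmc/hCNp/hCNm` at `r = 1`, with
`N n t = (1 − g^M(n, t − t₀)·g^env′(n, t − t₀))²`, `t₀ = b^±_n`): there is an absolute `C ≥ 0` such that for `γ ≥ 0`,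
`ε, ε_a, a₂, L₀, R′, w′ > 0` and every `0 < b` with `bγ ≤ ε_aL₀`, `b ≤ w′`, each profile is `C¹`, bounded by `1`, with
`|N′| ≤ C/b`, uniformly in the shift `t₀`. [cite: Grafakos2014, Prop. 3.1.2 (5)] -/
theorem exists_fibre_data_symProdM_H_sq :
    ∃ C : ℝ, 0 ≤ C ∧ ∀ {γ ε εa a₂ L₀ R w b : ℝ}, 0 ≤ γ → 0 < ε → 0 < εa → 0 < a₂ → 0 < L₀ → 0 < R → 0 < w → 0 < b →
      b * γ ≤ εa * L₀ → b ≤ w → ∀ (n : ℤ) (t₀ : ℝ),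
      ContDiff ℝ 1 (fun t : ℝ => (1 - smoothTransition ((|(n : ℝ)| - L₀) / (ε * L₀)) *
          (1 - smoothTransition ((γ * |t - t₀ + γ * n| - a₂ * |(n : ℝ)|) / (εa * L₀)) *
            smoothTransition ((γ * |t - t₀ - γ * n| - a₂ * |(n : ℝ)|) / (εa * L₀))) *
          ((1 - smoothTransition ((|(n : ℝ)| - R) / w)) * (1 - smoothTransition ((|t - t₀| - R) / w)))) ^ 2) ∧
      (∀ t : ℝ, |(1 - smoothTransition ((|(n : ℝ)| - L₀) / (ε * L₀)) *
          (1 - smoothTransition ((γ * |t - t₀ + γ * n| - a₂ * |(n : ℝ)|) / (εa * L₀)) *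
            smoothTransition ((γ * |t - t₀ - γ * n| - a₂ * |(n : ℝ)|) / (εa * L₀))) *
          ((1 - smoothTransition ((|(n : ℝ)| - R) / w)) * (1 - smoothTransition ((|t - t₀| - R) / w)))) ^ 2| ≤ 1) ∧
      ∀ t : ℝ, |deriv (fun t : ℝ => (1 - smoothTransition ((|(n : ℝ)| - L₀) / (ε * L₀)) *
          (1 - smoothTransition ((γ * |t - t₀ + γ * n| - a₂ * |(n : ℝ)|) / (εa * L₀)) *
            smoothTransition ((γ * |t - t₀ - γ * n| - a₂ * |(n : ℝ)|) / (εa * L₀))) *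
          ((1 - smoothTransition ((|(n : ℝ)| - R) / w)) * (1 - smoothTransition ((|t - t₀| - R) / w)))) ^ 2) t| ≤ C / b := by
  obtain ⟨CM, hCM0, hCM⟩ := exists_bound_deriv_midFactorH
  obtain ⟨CE, hCE0, hCE⟩ := exists_bound_deriv_envFactor
  refine ⟨2 * (CM + CE), by positivity, ?_⟩
  intro γ ε εa a₂ L₀ R w b hγ hε hεa ha₂ hL₀ hR hw hb hbγ hbw n t₀
  have e : (fun t : ℝ => smoothTransition ((|(n : ℝ)| - L₀) / (ε * L₀)) *
      (1 - smoothTransition ((γ * |t - t₀ + γ * n| - a₂ * |(n : ℝ)|) / (εa * L₀)) *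
        smoothTransition ((γ * |t - t₀ - γ * n| - a₂ * |(n : ℝ)|) / (εa * L₀)))) = fun t => 1 - (1 -
      smoothTransition ((|(n : ℝ)| - L₀) / (ε * L₀)) *
      (1 - smoothTransition ((γ * |t - t₀ + γ * n| - a₂ * |(n : ℝ)|) / (εa * L₀)) *
        smoothTransition ((γ * |t - t₀ - γ * n| - a₂ * |(n : ℝ)|) / (εa * L₀)))) := by
    funext t; ring
  have hM : ContDiff ℝ 1 (fun t : ℝ => smoothTransition ((|(n : ℝ)| - L₀) / (ε * L₀)) *
      (1 - smoothTransition ((γ * |t - t₀ + γ * n| - a₂ * |(n : ℝ)|) / (εa * L₀)) *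
        smoothTransition ((γ * |t - t₀ - γ * n| - a₂ * |(n : ℝ)|) / (εa * L₀)))) := by
    rw [e]; exact contDiff_const.sub (contDiff_symM_fibreH (γ := γ) hε hεa hL₀ ha₂ (n : ℝ) t₀)
  have hE : ContDiff ℝ 1 (fun t : ℝ => (1 - smoothTransition ((|(n : ℝ)| - R) / w)) *
      (1 - smoothTransition ((|t - t₀| - R) / w))) :=
    contDiff_envFactor hR hw (1 - smoothTransition ((|(n : ℝ)| - R) / w)) t₀ (m := 1)
  refine ⟨(contDiff_const.sub (hM.mul hE)).pow 2, fun t => ?_, fun t => ?_⟩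
  · obtain ⟨h0, h1⟩ := one_sub_mul_mem (midFactorH_mem γ ε εa a₂ L₀ n t₀ t).1 (midFactorH_mem γ ε εa a₂ L₀ n t₀ t).2
      (envFactor_mem R w n t₀ t).1 (envFactor_mem R w n t₀ t).2
    rw [abs_of_nonneg (sq_nonneg _)]; exact pow_le_one₀ h0 h1
  · have hMt := hCM hγ hε hεa ha₂ hL₀ hb hbγ n t₀ t
    rw [← e] at hMt
    obtain ⟨hdM, hM'⟩ := hMt
    obtain ⟨hdE, hE'⟩ := hCE hR hw hb hbw n t₀ t
    have h2 : 2 * (CM + CE) / b = 2 * (CM / b + CE / b) := by ring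
    rw [h2]
    exact abs_deriv_one_sub_mul_sq_le hdM hdE (midFactorH_mem γ ε εa a₂ L₀ n t₀ t).1 (midFactorH_mem γ ε εa a₂ L₀ n t₀ t).2
      (envFactor_mem R w n t₀ t).1 (envFactor_mem R w n t₀ t).2 hM' hE'

/-- **Lipschitz bound of `m̂²` along the `e_v`-axis** (input of `modulus_of_fibre_lipschitz` for `hω20/hω2`, giving
`wd₂(q) = (C/b)|q_v|` on the axis and `2` off it), with the constant of `exists_fibre_data_symProdM_H_sq`.
[cite: Grafakos2014, Prop. 3.1.2 (5)] -/
theorem exists_lipschitz_axis_symProdM_H_sq :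
    ∃ C : ℝ, 0 ≤ C ∧ ∀ {γ ε εa a₂ L₀ R w b : ℝ}, 0 ≤ γ → 0 < ε → 0 < εa → 0 < a₂ → 0 < L₀ → 0 < R → 0 < w → 0 < b →
      b * γ ≤ εa * L₀ → b ≤ w → ∀ k q : Fin 2 → ℤ, (∀ l : Fin 2, l ≠ 1 → q l = 0) →
        |(1 - smoothTransition ((|(k 0 : ℝ)| - L₀) / (ε * L₀)) *
              (1 - smoothTransition ((γ * |(k 1 : ℝ) + γ * (k 0)| - a₂ * |(k 0 : ℝ)|) / (εa * L₀)) *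
                smoothTransition ((γ * |(k 1 : ℝ) - γ * (k 0)| - a₂ * |(k 0 : ℝ)|) / (εa * L₀))) *
              ((1 - smoothTransition ((|(k 0 : ℝ)| - R) / w)) * (1 - smoothTransition ((|(k 1 : ℝ)| - R) / w)))) ^ 2 -
          (1 - smoothTransition ((|((k - q) 0 : ℝ)| - L₀) / (ε * L₀)) *
              (1 - smoothTransition ((γ * |((k - q) 1 : ℝ) + γ * ((k - q) 0)| - a₂ * |((k - q) 0 : ℝ)|) / (εa * L₀)) *
                smoothTransition ((γ * |((k - q) 1 : ℝ) - γ * ((k - q) 0)| - a₂ * |((k - q) 0 : ℝ)|) / (εa * L₀))) *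
              ((1 - smoothTransition ((|((k - q) 0 : ℝ)| - R) / w)) *
                (1 - smoothTransition ((|((k - q) 1 : ℝ)| - R) / w)))) ^ 2| ≤ C / b * |(q 1 : ℝ)| := by
  obtain ⟨C, hC0, hC⟩ := exists_fibre_data_symProdM_H_sq
  refine ⟨C, hC0, ?_⟩
  intro γ ε εa a₂ L₀ R w b hγ hε hεa ha₂ hL₀ hR hw hb hbγ hbw k q hq
  set Mf : (Fin 2 → ℤ) → ℝ → ℝ := fun k t =>
    (1 - smoothTransition ((|(k 0 : ℝ)| - L₀) / (ε * L₀)) *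
        (1 - smoothTransition ((γ * |t - 0 + γ * (k 0)| - a₂ * |(k 0 : ℝ)|) / (εa * L₀)) *
          smoothTransition ((γ * |t - 0 - γ * (k 0)| - a₂ * |(k 0 : ℝ)|) / (εa * L₀))) *
        ((1 - smoothTransition ((|(k 0 : ℝ)| - R) / w)) * (1 - smoothTransition ((|t - 0| - R) / w)))) ^ 2 with hMf
  have hdiff : ∀ k, Differentiable ℝ (Mf k) := fun k =>
    (hC hγ hε hεa ha₂ hL₀ hR hw hb hbγ hbw (k 0) 0).1.differentiable (by simp)
  have hder : ∀ k t, |deriv (Mf k) t| ≤ C / b := fun k t => (hC hγ hε hεa ha₂ hL₀ hR hw hb hbγ hbw (k 0) 0).2.2 t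
  refine abs_sub_le_of_fibre_deriv (μ := fun k : Fin 2 → ℤ =>
    (1 - smoothTransition ((|(k 0 : ℝ)| - L₀) / (ε * L₀)) *
        (1 - smoothTransition ((γ * |(k 1 : ℝ) + γ * (k 0)| - a₂ * |(k 0 : ℝ)|) / (εa * L₀)) *
          smoothTransition ((γ * |(k 1 : ℝ) - γ * (k 0)| - a₂ * |(k 0 : ℝ)|) / (εa * L₀))) *
        ((1 - smoothTransition ((|(k 0 : ℝ)| - R) / w)) * (1 - smoothTransition ((|(k 1 : ℝ)| - R) / w)))) ^ 2)
    (1 : Fin 2) (Mf := Mf) hdiff hder ?_ k q hq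
  intro k q hq
  obtain ⟨h0, h1⟩ := sub_apply_of_axis k q hq
  simp only [hMf, h0, h1, sub_zero]

/-- **The shift identity `hmNp/hmNm`**: with `mf n k = m̂(n, k_v)` and `N n t` the shifted squared fibre profile of
`exists_fibre_data_symProdM_H_sq` at `t₀ = b`, `mf n (k − b·e_v)² = N n (k_v)`. [folklore] -/
theorem symProdM_sub_single_sq_eq (γ ε εa a₂ L₀ R w : ℝ) (n b : ℤ) (k : Fin 2 → ℤ) :
    (1 - smoothTransition ((|(n : ℝ)| - L₀) / (ε * L₀)) *
        (1 - smoothTransition ((γ * |(((k - Pi.single (1 : Fin 2) b : Fin 2 → ℤ) 1 : ℤ) : ℝ) + γ * n| - a₂ * |(n : ℝ)|) /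
            (εa * L₀)) *
          smoothTransition ((γ * |(((k - Pi.single (1 : Fin 2) b : Fin 2 → ℤ) 1 : ℤ) : ℝ) - γ * n| - a₂ * |(n : ℝ)|) /
            (εa * L₀))) *
        ((1 - smoothTransition ((|(n : ℝ)| - R) / w)) *
          (1 - smoothTransition ((|(((k - Pi.single (1 : Fin 2) b : Fin 2 → ℤ) 1 : ℤ) : ℝ)| - R) / w)))) ^ 2 =
      (1 - smoothTransition ((|(n : ℝ)| - L₀) / (ε * L₀)) *
        (1 - smoothTransition ((γ * |(k 1 : ℝ) - b + γ * n| - a₂ * |(n : ℝ)|) / (εa * L₀)) *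
          smoothTransition ((γ * |(k 1 : ℝ) - b - γ * n| - a₂ * |(n : ℝ)|) / (εa * L₀))) *
        ((1 - smoothTransition ((|(n : ℝ)| - R) / w)) * (1 - smoothTransition ((|(k 1 : ℝ) - b| - R) / w)))) ^ 2 := by
  have h : (((k - Pi.single (1 : Fin 2) b : Fin 2 → ℤ) 1 : ℤ) : ℝ) = (k 1 : ℝ) - (b : ℝ) := by
    rw [(sub_single_one_apply k b).2]; push_cast; ring
  rw [h]

/-- **The fibre identity `hμM`/`hmf`** is definitional: on the fibre `k_h = n` the lattice symbol IS its fibre profile at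
`t = k_v` (recorded for the old symbol; used with `subst`). [folklore] -/
theorem symProdS_fibre_eq (γ ε εa a L R w : ℝ) (n : ℤ) (k : Fin 2 → ℤ) (hk : k 0 = n) :
    1 - smoothTransition ((|(k 0 : ℝ)| - L) / (ε * L)) * (1 - smoothTransition ((γ * |(k 1 : ℝ)| - a * |(k 0 : ℝ)|) / (εa * L))) *
        ((1 - smoothTransition ((|(k 0 : ℝ)| - R) / w)) * (1 - smoothTransition ((|(k 1 : ℝ)| - R) / w))) =
      1 - smoothTransition ((|(n : ℝ)| - L) / (ε * L)) * (1 - smoothTransition ((γ * |(k 1 : ℝ)| - a * |(n : ℝ)|) / (εa * L))) *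
        ((1 - smoothTransition ((|(n : ℝ)| - R) / w)) * (1 - smoothTransition ((|(k 1 : ℝ)| - R) / w))) := by
  rw [hk]

end Summit.AnomalousDissipation.AnomalousDissipation.Theorems.SawtoothPulseCascade.K1Symbol
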